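import Summits.AtomisticToContinuum.BoseEinsteinCondensation.Theses.BECCutLineWeakDisorder
import Literature.MathematicalPhysics.QuantumManyBody.SwapPurity
import Literature.MathematicalPhysics.QuantumManyBody.DyadicCoherentFractionLimit

/-!
# Crux `WitnessTransfer` (stmt-AtomisticToContinuum-14978) — the landscape functional has floor `‖f‖₂²`

Crux-disprover result (route BECCutLineWeakDisorder, seat
`refuter-cdisprove-stmt-AtomisticToContinuum-14978-0`), TIGHTNESS of the common functional of the two
sides of the crux `WitnessTransfer = (TwoReplicaTransienceBound → LandscapeBound)`:

  `R_L(f) := ∫ L³ m(Y)²/s(Y)² dY ≥ ∫ |f|² = ‖f‖₂²`,  `m(Y) = ∫ |f(x,Y)|² dx`, `s(Y) = ∫ |f(x,Y)| dx`,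

for EVERY measurable `f` on `(ℝ³)^{n+1}` whose slices vanish off the box `Λ_L` and are integrable
(`lintegral_sq_le_landscapeRatio`; slice-wise Cauchy–Schwarz `s² ≤ |Λ_L| m`). Consequences:

* `one_le_landscapeRatio` — every admissible trial state `Ψ ∈ TrialState (n+1) L` has `R_L(Ψ) ≥ 1`;
* `landscapeClause_false_of_lt_one`, `not_landscapeBound_with_constant_lt_one` — the hinge clause of
  `LandscapeBound` at ANY `(v, ρ)` with a constant `C < 1` is FALSE, hence so is the route decl with its
  `∃ C, 0 < C ∧ …` replaced by `∃ C, C < 1 ∧ …`: the existential constant of the hinge has the floor `1`,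
  attained only by flat slices (free Dirichlet gas: `(π²/8)³ ≈ 1.878`; the route's conjectured dilute
  value `1 + O(√(ρa³))` sits just above the floor);
* `one_le_twoReplicaRatio` — the same floor for the finite-`T` Feynman–Kac witness
  `Ψ_T = fkWitness v L T 1` whenever it is NON-degenerate (`‖e^{-TH}1‖₂ ≠ 0`), and hence
  `fkNormSq_eq_zero_of_twoReplicaClause_lt_one` — a two-replica ratio `< 1` can only come from the JUNK
  witness `Ψ_T ≡ 0` (`‖e^{-TH}1‖₂ = 0`, ratio `0/0 = 0`): the engine clause with `C < 1` certifies
  nothing but degeneracy, which is exactly the vacuity channel of the transfer named in the item's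
  why-might-fail.

All [folklore] (Cauchy–Schwarz, Tonelli).
-/

noncomputable section

open MeasureTheory Filter Set Metric
open scoped ENNReal NNReal Topology

namespace Summit.AtomisticToContinuum.BoseEinsteinCondensation.Theorems.WitnessTransfer.Negative

open Literature.MathematicalPhysics.QuantumManyBody.BoseGas
open Summit.AtomisticToContinuum.BoseEinsteinCondensation.Theses.BECCutLineWeakDisorder

variable {n : ℕ}

/-! ## §1 Slice-wise Cauchy–Schwarz and the floor of the functional -/

/-- Cauchy–Schwarz on the one-particle box: `(∫ g)² ≤ |Λ_L| ∫ g²` for `g ≥ 0` vanishing off `Λ_L`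
(`|Λ_L| = (ofReal L)³`, junk `0` for `L ≤ 0`). [folklore] -/
theorem lintegral_sq_le_volume_box_mul {L : ℝ} {g : Space → ℝ≥0∞} (hg : Measurable g)
    (h0 : ∀ x, x ∉ box L → g x = 0) :
    (∫⁻ x, g x) ^ 2 ≤ ENNReal.ofReal L ^ 3 * ∫⁻ x, g x ^ 2 := by
  have hbox := AtomisticToContinuum.BECInfraredBound.measurableSet_box L
  have hind : ∀ x, (box L).indicator (fun _ => (1 : ℝ≥0∞)) x * g x = g x := by
    intro x
    by_cases hx : x ∈ box L
    · rw [Set.indicator_of_mem hx, one_mul]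
    · rw [Set.indicator_of_notMem hx, zero_mul, h0 x hx]
  have hsq : (fun x => (box L).indicator (fun _ => (1 : ℝ≥0∞)) x ^ 2) =
      (box L).indicator fun _ => (1 : ℝ≥0∞) := by
    funext x
    by_cases hx : x ∈ box L
    · simp [Set.indicator_of_mem hx]
    · simp [Set.indicator_of_notMem hx]
  calc (∫⁻ x, g x) ^ 2 = (∫⁻ x, (box L).indicator (fun _ => (1 : ℝ≥0∞)) x * g x) ^ 2 := by
        simp_rw [hind]
    _ ≤ (∫⁻ x, (box L).indicator (fun _ => (1 : ℝ≥0∞)) x ^ 2) * ∫⁻ x, g x ^ 2 :=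
        lintegral_mul_sq_le volume ((measurable_const.indicator hbox).aemeasurable) hg.aemeasurable
    _ = ENNReal.ofReal L ^ 3 * ∫⁻ x, g x ^ 2 := by
        rw [hsq, lintegral_indicator hbox, setLIntegral_const, one_mul,
          AtomisticToContinuum.BECInfraredBound.volume_box]

/-- `[0, ∞]` arithmetic of the integrand: if `s² ≤ A m`, `s < ∞` and `s = 0 ⇒ m = 0`, then
`m ≤ A m² / s²`. [folklore] -/
theorem le_mul_sq_div_sq {A m s : ℝ≥0∞} (h : s ^ 2 ≤ A * m) (hs : s ≠ ⊤) (hsm : s = 0 → m = 0) :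
    m ≤ A * m ^ 2 / s ^ 2 := by
  rcases eq_or_ne s 0 with h0 | h0
  · simp [hsm h0]
  · rw [ENNReal.le_div_iff_mul_le (Or.inl (pow_ne_zero 2 h0)) (Or.inl (ENNReal.pow_ne_top hs))]
    calc m * s ^ 2 ≤ m * (A * m) := by gcongr
      _ = A * m ^ 2 := by ring

/-- The box `Λ_L` is empty for `L ≤ 0`. [folklore] -/
theorem not_mem_box_of_nonpos {L : ℝ} (hL : L ≤ 0) (x : Space) : x ∉ box L :=
  fun hx => absurd ((hx 0).1.trans (hx 0).2) (not_lt.2 hL)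

/-- **The floor of the landscape functional.** For a measurable `g ≥ 0` on `(ℝ³)^{n+1}` whose slices
`x ↦ g(x, Y)` vanish off `Λ_L` and are integrable,
`∫ g² ≤ ∫ L³ m(Y)²/s(Y)² dY` with `m = ∫ g(·,Y)²`, `s = ∫ g(·,Y)` (Tonelli in `x :: Y` and, slice by
slice, `s² ≤ L³ m`). [folklore] -/
theorem lintegral_sq_le_landscapeRatio {L : ℝ} {g : Config (n + 1) → ℝ≥0∞} (hg : Measurable g)
    (h0 : ∀ (x : Space) (Y : Config n), x ∉ box L → g (Matrix.vecCons x Y) = 0)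
    (hfin : ∀ Y : Config n, ∫⁻ x, g (Matrix.vecCons x Y) ≠ ⊤) :
    ∫⁻ X, g X ^ 2 ≤ ∫⁻ Y : Config n, ENNReal.ofReal (L ^ 3) *
        (∫⁻ x, g (Matrix.vecCons x Y) ^ 2) ^ 2 / (∫⁻ x, g (Matrix.vecCons x Y)) ^ 2 := by
  rw [lintegral_config_succ (hg.pow_const 2)]
  refine lintegral_mono fun Y => ?_
  have hgY : Measurable fun x => g (Matrix.vecCons x Y) :=
    hg.comp (measurable_vecCons.comp (measurable_id.prodMk measurable_const))
  refine le_mul_sq_div_sq ?_ (hfin Y) ?_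
  · have h := lintegral_sq_le_volume_box_mul hgY (fun x hx => h0 x Y hx)
    rcases le_or_gt 0 L with hL | hL
    · rwa [← ENNReal.ofReal_pow hL] at h
    · have hz : ∀ x, g (Matrix.vecCons x Y) = 0 := fun x => h0 x Y (not_mem_box_of_nonpos hL.le x)
      simp [hz]
  · intro hs
    have hae := (lintegral_eq_zero_iff hgY).1 hs
    refine (lintegral_eq_zero_iff (hgY.pow_const 2)).2 ?_
    filter_upwards [hae] with x hx
    simp only [Pi.zero_apply] at hx ⊢
    simp [hx]

/-! ## §2 Admissible trial states: `R_L(Ψ) ≥ 1`, so the hinge constant cannot be `< 1` -/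

/-- The slice `x ↦ Ψ(x, Y)` of an admissible trial state is integrable (continuous with compact
support, the insertion `x ↦ x :: Y` being an isometry). [folklore] -/
theorem integrable_slice {L : ℝ} (Ψ : TrialState (n + 1) L) (Y : Config n) :
    Integrable (fun x : Space => Ψ.ψ (Matrix.vecCons x Y)) := by
  have hc : Continuous fun x : Space => Ψ.ψ (Matrix.vecCons x Y) :=
    Ψ.contDiff.continuous.comp (continuous_id.matrixVecCons continuous_const)
  have he : Isometry fun x : Space => (Matrix.vecCons x Y : Config (n + 1)) := fun x y => by
    rw [edist_dist, edist_dist, dist_vecCons_vecCons]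
  exact hc.integrable_of_hasCompactSupport
    (Ψ.hasCompactSupport.comp_isClosedEmbedding he.isClosedEmbedding)

/-- **Every admissible trial state has landscape ratio `≥ 1`** (`Ψ ∈ TrialState (n+1) L`, any `n`,
any `L`; no sign condition). [folklore] -/
theorem one_le_landscapeRatio {L : ℝ} (Ψ : TrialState (n + 1) L) :
    1 ≤ ∫⁻ Y : Config n, ENNReal.ofReal (L ^ 3) *
        (∫⁻ x, (‖Ψ.ψ (Matrix.vecCons x Y)‖₊ : ℝ≥0∞) ^ 2) ^ 2 /
          (∫⁻ x, (‖Ψ.ψ (Matrix.vecCons x Y)‖₊ : ℝ≥0∞)) ^ 2 := by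
  have hΨm : Measurable Ψ.ψ := Ψ.contDiff.continuous.measurable
  rw [← Ψ.norm_eq]
  refine lintegral_sq_le_landscapeRatio (g := fun X => (‖Ψ.ψ X‖₊ : ℝ≥0∞))
    hΨm.nnnorm.coe_nnreal_ennreal ?_ ?_
  · intro x Y hx
    have hX : (Matrix.vecCons x Y : Config (n + 1)) ∉ boxN (n + 1) L := fun h => hx (by simpa using h 0)
    simp [Ψ.eq_zero _ hX]
  · intro Y
    exact (hasFiniteIntegral_iff_enorm.mp (integrable_slice Ψ Y).2).ne

/-- **Tightness: the hinge constant cannot be taken below `1`.** For ANY potential `v` and density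
`ρ`, the hinge clause of `LandscapeBound` (verbatim the part of the route decl after `∃ C : ℝ, 0 < C ∧`)
with a constant `C < 1` is false: already `δ = 1` and any `n` of the eventual set give a trial state of
ratio `≤ C < 1 ≤` ratio. [folklore] -/
theorem landscapeClause_false_of_lt_one {v : ℝ → ℝ≥0∞} {ρ C : ℝ} (hC : C < 1) :
    ¬ (∀ᶠ n : ℕ in Filter.atTop, ∀ δ : ENNReal, 0 < δ →
      ∃ Ψ : TrialState (n + 1) (sideLength ρ (n + 1)),
        energy v Ψ ≤ groundStateEnergy v (n + 1) (sideLength ρ (n + 1)) + δ ∧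
        (∀ X, Ψ.ψ X = (‖Ψ.ψ X‖ : ℂ)) ∧
        ∫⁻ Y : Config n, ENNReal.ofReal (sideLength ρ (n + 1) ^ 3) *
            (∫⁻ x, (‖Ψ.ψ (Matrix.vecCons x Y)‖₊ : ENNReal) ^ 2) ^ 2 /
              (∫⁻ x, (‖Ψ.ψ (Matrix.vecCons x Y)‖₊ : ENNReal)) ^ 2 ≤ ENNReal.ofReal C) := by
  intro h
  obtain ⟨n, hn⟩ := h.exists
  obtain ⟨Ψ, -, -, hR⟩ := hn 1 one_pos
  exact absurd ((one_le_landscapeRatio Ψ).trans hR) (not_le.2 (ENNReal.ofReal_lt_one.2 hC))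

/-- Hence `LandscapeBound` with the existential constant pinned below `1` — `∃ C, C < 1 ∧ …` in place of
`∃ C, 0 < C ∧ …`, everything else verbatim — is false (instantiate at the free gas `v = 0`, which is
admissible, and any admissible density). [folklore] -/
theorem not_landscapeBound_with_constant_lt_one :
    ¬ (∀ v : ℝ → ℝ≥0∞, IsRepulsiveFiniteRange v → ∃ ρ₀ : ℝ, 0 < ρ₀ ∧ ∀ ρ : ℝ, 0 < ρ → ρ < ρ₀ →
      ∃ C : ℝ, C < 1 ∧ ∀ᶠ n : ℕ in Filter.atTop, ∀ δ : ENNReal, 0 < δ →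
        ∃ Ψ : TrialState (n + 1) (sideLength ρ (n + 1)),
          energy v Ψ ≤ groundStateEnergy v (n + 1) (sideLength ρ (n + 1)) + δ ∧
          (∀ X, Ψ.ψ X = (‖Ψ.ψ X‖ : ℂ)) ∧
          ∫⁻ Y : Config n, ENNReal.ofReal (sideLength ρ (n + 1) ^ 3) *
              (∫⁻ x, (‖Ψ.ψ (Matrix.vecCons x Y)‖₊ : ENNReal) ^ 2) ^ 2 /
                (∫⁻ x, (‖Ψ.ψ (Matrix.vecCons x Y)‖₊ : ENNReal)) ^ 2 ≤ ENNReal.ofReal C) := by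
  intro h
  have hv : IsRepulsiveFiniteRange (fun _ : ℝ => (0 : ℝ≥0∞)) := ⟨measurable_const, 0, fun _ _ => rfl⟩
  obtain ⟨ρ₀, hρ₀, hρ⟩ := h _ hv
  obtain ⟨C, hC, hcl⟩ := hρ (ρ₀ / 2) (by positivity) (by linarith)
  exact landscapeClause_false_of_lt_one hC hcl

/-! ## §3 The finite-`T` Feynman–Kac witness: the same floor unless it is the junk witness `0` -/

/-- `‖e^{-TH_N}1‖₂² ≤ |Λ_L^N| < ∞` (`e^{-TH}1 ≤ 𝟙_{Λ^N}` for `T ≥ 0`). [folklore] -/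
theorem fkNormSq_one_ne_top {N : ℕ} (v : ℝ → ℝ≥0∞) (L : ℝ) {T : ℝ} (hT : 0 ≤ T) :
    fkNormSq (N := N) v L T (fun _ => 1) ≠ ⊤ := by
  refine ne_top_of_le_ne_top (volume_boxN_lt_top N L).ne ?_
  rw [fkNormSq_def, ← lintegral_indicator_one (measurableSet_boxN N L)]
  refine lintegral_mono fun X => ?_
  by_cases hX : X ∈ boxN N L
  · rw [Set.indicator_of_mem hX]
    have h1 : fkSemigroup v L T (fun _ => 1) X ≤ 1 := fkPartition_le_one v L T X
    calc fkSemigroup v L T (fun _ => 1) X ^ 2 ≤ 1 ^ 2 := by gcongr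
      _ = 1 := one_pow 2
  · rw [Set.indicator_of_notMem hX, fkSemigroup_of_notMem v hT _ hX]
    simp

/-- The finite-`T` witness is bounded: `0 ≤ Ψ_T ≤ ‖e^{-TH}1‖₂⁻¹` (`e^{-TH}1 ≤ 1`). [folklore] -/
theorem fkWitness_one_le {N : ℕ} (v : ℝ → ℝ≥0∞) (L T : ℝ) (X : Config N) :
    fkWitness (N := N) v L T (fun _ => 1) X ≤
      (Real.sqrt (fkNormSq (N := N) v L T (fun _ => 1)).toReal)⁻¹ := by
  rw [fkWitness_apply, div_eq_mul_inv]
  refine mul_le_of_le_one_left (inv_nonneg.2 (Real.sqrt_nonneg _)) ?_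
  have h1 : fkSemigroup v L T (fun _ => 1) X ≤ 1 := fkPartition_le_one v L T X
  exact ENNReal.toReal_le_of_le_ofReal zero_le_one (by simpa using h1)

/-- **The two-replica ratio of a NON-degenerate witness is `≥ 1`**: if `‖e^{-TH_N}1‖₂ ≠ 0` (`T ≥ 0`,
`v` measurable), then `∫ L³ m_T²/s_T² ≥ 1` for `Ψ_T = fkWitness v L T 1`. [folklore] -/
theorem one_le_twoReplicaRatio {v : ℝ → ℝ≥0∞} (hv : Measurable v) {L T : ℝ} (hT : 0 ≤ T)
    (hZ : fkNormSq (N := n + 1) v L T (fun _ => 1) ≠ 0) :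
    1 ≤ ∫⁻ Y : Config n, ENNReal.ofReal (L ^ 3) *
        (∫⁻ x, (‖fkWitness (N := n + 1) v L T (fun _ => (1 : ℝ≥0∞)) (Matrix.vecCons x Y)‖₊ :
          ℝ≥0∞) ^ 2) ^ 2 /
        (∫⁻ x, (‖fkWitness (N := n + 1) v L T (fun _ => (1 : ℝ≥0∞)) (Matrix.vecCons x Y)‖₊ :
          ℝ≥0∞)) ^ 2 := by
  set Ψ := fkWitness (N := n + 1) v L T (fun _ => (1 : ℝ≥0∞)) with hΨ
  have hZtop := fkNormSq_one_ne_top (N := n + 1) v L hT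
  have hΨm : Measurable Ψ := measurable_fkWitness hv L T measurable_const
  have hnn : ∀ X, (‖Ψ X‖₊ : ℝ≥0∞) = ENNReal.ofReal (Ψ X) := fun X => by
    rw [← enorm_eq_nnnorm, Real.enorm_of_nonneg (fkWitness_nonneg v L T _ X)]
  have hnorm : ∫⁻ X, (‖Ψ X‖₊ : ℝ≥0∞) ^ 2 = 1 := by
    simp_rw [hnn]
    exact lintegral_fkWitness_sq hv L T measurable_const hZ hZtop
  rw [← hnorm]
  refine lintegral_sq_le_landscapeRatio (g := fun X => (‖Ψ X‖₊ : ℝ≥0∞))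
    hΨm.nnnorm.coe_nnreal_ennreal ?_ ?_
  · intro x Y hx
    have hX : (Matrix.vecCons x Y : Config (n + 1)) ∉ boxN (n + 1) L := fun h => hx (by simpa using h 0)
    simp [hΨ, fkWitness_of_notMem v hT _ hX]
  · intro Y
    -- the slice is bounded by `K = ‖e^{-TH}1‖₂⁻¹` and vanishes off the box
    set K : ℝ := (Real.sqrt (fkNormSq (N := n + 1) v L T (fun _ => 1)).toReal)⁻¹
    have hK : 0 ≤ K := inv_nonneg.2 (Real.sqrt_nonneg _)
    have hbox := AtomisticToContinuum.BECInfraredBound.measurableSet_box L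
    refine ne_top_of_le_ne_top (b := ∫⁻ x, (box L).indicator (fun _ => ENNReal.ofReal K) x) ?_ ?_
    · rw [lintegral_indicator hbox, setLIntegral_const, AtomisticToContinuum.BECInfraredBound.volume_box]
      exact ENNReal.mul_ne_top ENNReal.ofReal_ne_top (ENNReal.pow_ne_top ENNReal.ofReal_ne_top)
    · refine lintegral_mono fun x => ?_
      by_cases hx : x ∈ box L
      · rw [Set.indicator_of_mem hx, hnn]
        exact ENNReal.ofReal_le_ofReal (fkWitness_one_le v L T _)
      · have hX : (Matrix.vecCons x Y : Config (n + 1)) ∉ boxN (n + 1) L :=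
          fun h => hx (by simpa using h 0)
        simp [hΨ, fkWitness_of_notMem v hT _ hX]

/-- **An engine constant `< 1` certifies only degeneracy.** If the engine clause of
`TwoReplicaTransienceBound` (verbatim the part of the route decl after `∃ C : ℝ, 0 < C ∧`) holds at
`(v, ρ)` with `C < 1` (`v` measurable), then eventually in `n` the Feynman–Kac witnesses are the JUNK
function `0` for every `T ≥ 1`: `‖e^{-TH_{n+1}}1‖₂ = 0`, i.e. almost every starting configuration is
killed almost surely (the ratio of the junk witness is `0/0 = 0`). [folklore] -/
theorem fkNormSq_eq_zero_of_twoReplicaClause_lt_one {v : ℝ → ℝ≥0∞} (hv : Measurable v) {ρ C : ℝ}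
    (hC : C < 1)
    (h : ∀ᶠ n : ℕ in Filter.atTop, ∀ T : ℝ, 1 ≤ T →
      ∫⁻ Y : Config n, ENNReal.ofReal (sideLength ρ (n + 1) ^ 3) *
          (∫⁻ x, (‖fkWitness (N := n + 1) v (sideLength ρ (n + 1)) T (fun _ => (1 : ENNReal))
            (Matrix.vecCons x Y)‖₊ : ENNReal) ^ 2) ^ 2 /
          (∫⁻ x, (‖fkWitness (N := n + 1) v (sideLength ρ (n + 1)) T (fun _ => (1 : ENNReal))
            (Matrix.vecCons x Y)‖₊ : ENNReal)) ^ 2 ≤ ENNReal.ofReal C) :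
    ∀ᶠ n : ℕ in Filter.atTop, ∀ T : ℝ, 1 ≤ T →
      fkNormSq (N := n + 1) v (sideLength ρ (n + 1)) T (fun _ => 1) = 0 := by
  filter_upwards [h] with n hn T hT
  by_contra hZ
  exact absurd ((one_le_twoReplicaRatio hv (zero_le_one.trans hT) hZ).trans (hn T hT))
    (not_le.2 (ENNReal.ofReal_lt_one.2 hC))

end Summit.AtomisticToContinuum.BoseEinsteinCondensation.Theorems.WitnessTransfer.Negative

end
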